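import Summits.ResolutionOfSingularities.ResolutionOfSingularities.Theorems.MarkedTransferCampaignW46Threefolds
import HarnessLib

/-!
# [OURS · L1 W4.6 rung (ii)] PROGRESS SHAPES of the ∇-centred typed procedure — «the procedure can take its next step»
# and «the next state is resolved or again has a résumé»: STATEMENT module (definitions only)

Cell res-hironaka, LADDER-RESOLUTION rung L (D-0089), slot W4.6, rung (ii); seat res-L1-s46-pv-3 (gen 2). Host route
MarkedTransfer, host item `HypersurfaceOrderReductionDimLeThree` (stmt-16156); `--kind definition --supports` it.

HONEST FRAMING. Everything below is OURS: campaign definitions over the shared vocabulary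
`Theorems/MarkedTransferCampaignW46TypedProcedure.lean` (`Resume`, `StepNabla`, `Regime`) and `…Threefolds.lean`
(`regimeII`). NOTHING here is a statement of H. Hironaka's manuscript (2017-03-23, [Hironaka2017]) and nothing asserts that
any statement of it holds. No theorem; the EXHAUSTION theorems («termination + progress ⇒ every state is resolved by an
`E`-permissible LSB», Def. 2.4) are the companion module `MarkedTransferCampaignW46ThreefoldsResolved`. AI review is weaker
than expert review.

## Why

`TerminatesNabla` («no infinite ∇-centred run») is the NEGATIVE half of «repeatedly but finitely many times … we obtain an
embedded resolution» (Th. 16.13 p.87 l.26–28). The POSITIVE half — that the procedure actually REACHES a resolved state — needs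
that the procedure can always continue from an unresolved state: (i) from every state with a résumé a ∇-STEP exists (the
blow-up of `Z` along a component of the terminal plat `∇(E)` is again an ambient datum — over a perfect field a kernel fact,
`Hironaka2017.ERSHypersurface.ambient_blowup`, once the component is smooth irreducible, which is the typed Def. 15.12
«`∇(E)` smooth»), and (ii) the transform `E′` is either RESOLVED (`Sing(E′) = ∅`) or again has a résumé read by `Rd` (résumé
EXISTENCE, row 091 `U78L2` / Def. 15.8 — posited by the manuscript, never constructed in the tree; cf. res-L1-s46-pv-1's
`ResumesCover`). `Progress` packages (i)+(ii) for a regime; `NablaStepExists` is (i) alone (for `regimeII`, (ii) is then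
`ResumesCover` on the standard unresolved regime-(ii) states, since regime (ii) and standardness propagate along steps,
`…ThreefoldsRegime`).

References: shared module v4 (p479675); Threefolds.lean v5 (p485187); `…ThreefoldsRegime` (p480316); res-L1-s46-pv-1
`MarkedTransferCampaignW46LiteralCentreProcrastination` (`ResumesCover`). H. Hironaka, ms. 2017-03-23, Th. 16.13 p.87 l.26–28,
§16.3 p.87 l.14–24, Def. 15.8 p.78, Def. 15.12 p.80 l.36 – p.81 l.4, Def. 2.4 p.6 — scope only, under adjudication, not cited as
fact. [Hironaka2017]
-/

noncomputable section

set_option linter.dupNamespace false -- mandated namespace of this single-conjunct summit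

open CategoryTheory AlgebraicGeometry TopologicalSpace

namespace Summit.ResolutionOfSingularities.ResolutionOfSingularities.Theorems

namespace CampaignW46

open Literature.AlgebraicGeometry.Resolution
open Literature.AlgebraicGeometry.Hironaka2017.S02Preliminaries
open Literature.AlgebraicGeometry.Hironaka2017.Datum
open Literature.AlgebraicGeometry.Hironaka2017.S15ARSchemes
open Literature.AlgebraicGeometry.Hironaka2017.S16Proof

universe u

variable {n : ℕ} {p : ℕ} [Fact p.Prime] {K : Type u} [Field K] [CharP K p]

/-- [OURS · L1 W4.6] replaces the role of «we apply Th. (16.6) … repeatedly … replacing 𝔜's by their transforms» (§16.3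
p.87 l.14–17) AS THE ABILITY TO CONTINUE, restricted to the regime `Rg`, as a HYPOTHESIS SHAPE on `N`/`Rd`; NOT a statement
of the manuscript. PROGRESS: from every state `(A, E)` in `Rg` with a résumé `R` read by `Rd` there is a ∇-STEP
`s : StepNabla R A′` (centre = an irreducible component of `∇(E)`, blow-up onto an ambient datum `A′`) landing in `Rg`, after
which the transform `E′` is either RESOLVED (`Sing(E′) = ∅`) or has a résumé read by `Rd`. Never asserted; the companion
module derives it in regime (ii) from `NablaStepExists` + résumé coverage. [folklore] -/
def Progress (N : Notions.{u} n) (Rd : Reading p K N) (Rg : Regime p K) : Prop :=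
  ∀ (A : AmbientDatum p K) (E : IdealExponent A.Z) (R : Resume N A E), Rg A E → Rd A E R →
    ∃ (A' : AmbientDatum p K) (s : StepNabla R A'), Rg A' s.toStep.E' ∧
      (s.toStep.E'.sing = ∅ ∨ ∃ R' : Resume N A' s.toStep.E', Rd A' s.toStep.E' R')

/-- [OURS · L1 W4.6] replaces the role of «the blowup `π : Z′ → Z` with center `D`» BEING AVAILABLE at every stage (Th. 16.6
p.84 l.5–6 with (4) l.29 «`D = ∇`»; the next `Z′` is again an ambient datum, §2 p.4 l.22–24), restricted to `Rg`, as a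
HYPOTHESIS SHAPE on `N`/`Rd`; NOT a statement of the manuscript: from every state in `Rg` with a résumé read by `Rd` SOME
∇-step exists. (Over a perfect field the blow-up along a smooth irreducible centre inside `Sing(E)` is again an ambient
datum — tree `ERSHypersurface.ambient_blowup`; what remains posited is a smooth irreducible COMPONENT of the typed terminal
plat, Def. 15.12.) Never asserted. [folklore] -/
def NablaStepExists (N : Notions.{u} n) (Rd : Reading p K N) (Rg : Regime p K) : Prop :=
  ∀ (A : AmbientDatum p K) (E : IdealExponent A.Z) (R : Resume N A E), Rg A E → Rd A E R →
    ∃ A' : AmbientDatum p K, Nonempty (StepNabla R A')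

/-- [OURS · L1 W4.6 rung (ii)] `Progress` at `regimeII` (threefold hypersurface states), relative to the named `N`, `Rd`.
Not asserted. [folklore] -/
def ProgressII (N : Notions.{u} n) (Rd : Reading p K N) : Prop :=
  Progress N Rd regimeII

/-- [OURS · L1 W4.6 rung (ii)] `NablaStepExists` at `regimeII` (threefold hypersurface states), relative to the named `N`,
`Rd`. Not asserted. [folklore] -/
def NablaStepExistsII (N : Notions.{u} n) (Rd : Reading p K N) : Prop :=
  NablaStepExists N Rd regimeII

/-! ## The sub-case of IRREDUCIBLE terminal plats (appended 2026-08-27, append-only): there step existence is a KERNEL FACT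
over a perfect field (companion `MarkedTransferCampaignW46ThreefoldsStepExists`: the blow-up of `Z` along the whole smooth
irreducible `∇(E)` exists and is again an ambient datum), every ∇-centred run is a whole-∇ run, and the whole-∇ reduction
(four shapes, no Eq. (128), no component measure) already gives `TerminatesNabla`. -/

/-- [OURS · L1 W4.6] SUB-CASE HYPOTHESIS «the terminal plat `∇(E)` is IRREDUCIBLE» for every state in `Rg` with a résumé
read by `Rd` (the case «`D = ∇`» of Th. 16.6 (4) p.84 l.29 at every stage; Def. 15.12 p.80 l.36–37 posits `∇(E)` smooth
closed non-empty, NOT irreducible — this is a restriction to a sub-case, not a reading of a printed claim). NOT a statement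
of the manuscript; never asserted. [folklore] -/
def NablaIrreducible (N : Notions.{u} n) (Rd : Reading p K N) (Rg : Regime p K) : Prop :=
  ∀ (A : AmbientDatum p K) (E : IdealExponent A.Z) (R : Resume N A E), Rg A E → Rd A E R →
    IsIrreducible (R.nabla : Set A.Z)

/-- [OURS · L1 W4.6 rung (ii)] `NablaIrreducible` at `regimeII`, relative to the named `N`, `Rd`. Not asserted. [folklore] -/
def NablaIrreducibleII (N : Notions.{u} n) (Rd : Reading p K N) : Prop :=
  NablaIrreducible N Rd regimeII

end CampaignW46

end Summit.ResolutionOfSingularities.ResolutionOfSingularities.Theorems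

end
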